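import Summits.AtomisticToContinuum.HydrodynamicLimit.Theorems.AntiMazurCoboundariesKineticFluxLdDecayHTheoremObjects
import Summits.AtomisticToContinuum.HydrodynamicLimit.Theorems.OneFlightGossipEngineKineticCurrentsWindowLDUniformLedgerAssemblyDuality
import Literature.Probability.Divergences.DonskerVaradhan
import HarnessLib

/-!
# Velocity entropy budget for the crux line `h-theorem-dissipation-budget` (crux `KineticFluxLdDecay`,
# stmt-AtomisticToContinuum-10967) — registered stub `stub_velocityEntropyBudget` (S3)

In the frame of `Theorems/AntiMazurCoboundariesKineticFluxLdDecayHTheoremObjects.lean` (statement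
`HTheorem.VelocityEntropyBudget`): for constant profiles `a, θ > 0`, `σ ≤ 1/2`, a probability law `ν` with
`KL(ν ‖ G_N) < ∞` and every time `t`, the velocity relative entropy of the reduced one-body law `f_t` of `ν`
is budgeted by the `N`-body entropy, `(N+1) · KL(f_t ‖ (f_t)₁ ⊗ γ) ≤ KL(ν ‖ G_N)` (finite).

Proof (Donsker–Varadhan duality, no disintegration of `ν`):

* `integral_oneBodyLaw_eq` — `(N+1) ∫ g df_t = E_ν[∑ᵢ g(xᵢ(t), wᵢ(t))]` for bounded measurable one-body `g`
  (unfolding `oneBodyLaw`: `integral_smul_measure`, `integral_finsetSum_measure`, `integral_map`);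
* `lintegral_exp_sum_reducedCoord_gibbs_le` — for a velocity-normalised `g` (`∫ e^{g(x,·)} dγ = 1` for all
  `x`) the exponential moment `E_G[exp ∑ᵢ g(xᵢ, wᵢ)] ≤ 1` (Gaussian one-site factorisation
  `lintegral_exp_sum_localGibbsMeasure_const_le` transported to reduced velocities by
  `lintegral_gaussMeasure_eq_lintegral_stdGaussian_sv`);
* `integral_oneBodyLaw_le_klDiv` — hence, by flow-invariance of `G_N`
  (`integral_comp_flow_localGibbsLaw_const`) and the Donsker–Varadhan entropy inequality
  (`LedgerAssembly.integral_le_klDiv_add_log`), `(N+1) ∫ g df_t ≤ KL(ν ‖ G_N)` for every bounded measurable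
  velocity-normalised `g`;
* `stub_velocityEntropyBudget` — the conditional Donsker–Varadhan upper bound
  `Literature.Probability.Divergences.klDiv_fst_prod_le_of_forall` turns the family of test inequalities into
  `KL(f_t ‖ (f_t)₁ ⊗ γ) ≤ KL(ν ‖ G_N)/(N+1)`.

Reference: C. Kipnis, C. Landim, *Scaling Limits of Interacting Particle Systems* (1999), App. 1 §8.
-/

noncomputable section

open MeasureTheory ProbabilityTheory Set Filter InformationTheory
open scoped ENNReal

namespace Summit.AtomisticToContinuum.HydrodynamicLimit.Theorems.HTheorem

open Literature.MathematicalPhysics.KineticTheory (T3 V3 hsDiameter localGibbsLaw gaussMeasure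
  localGibbsLaw_eq lintegral_exp_sum_localGibbsMeasure_const_le lintegral_gaussMeasure_eq_lintegral_stdGaussian_sv)
open Literature.Analysis.FluidPDE (HardSphereFlow Config)
open Summit.AtomisticToContinuum.HydrodynamicLimit.Theorems.KineticCurrentsWindowLDUniformGossip
  (LedgerAssembly.integral_le_klDiv_add_log)

/-! ### The one-body sum observable -/

/-- The one-body sum `Y(z) = ∑ᵢ g(xᵢ(t), wᵢ(t))` of a measurable `g` along the flow is measurable. -/
theorem measurable_sum_reducedCoord_flow {σ : ℝ} (θ : ℝ) (u₀ : V3) (N : ℕ) (Φ : Flow σ N) (t : ℝ)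
    {g : T3 × V3 → ℝ} (hgm : Measurable g) :
    Measurable fun z : Phase N => ∑ i, g (reducedCoord θ u₀ (N + 1) i (Φ.flow t z)) :=
  Finset.measurable_sum _ fun i _ =>
    hgm.comp ((measurable_reducedCoord θ u₀ (N + 1) i).comp (Φ.measurable_flow t))

/-- The one-body sum of a bounded `g` is bounded: `|∑ᵢ g(·)| ≤ (N+1) C`. -/
theorem abs_sum_reducedCoord_le {σ : ℝ} (θ : ℝ) (u₀ : V3) (N : ℕ) (Φ : Flow σ N) (t : ℝ)
    {g : T3 × V3 → ℝ} {C : ℝ} (hgC : ∀ p, |g p| ≤ C) (z : Phase N) :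
    |∑ i, g (reducedCoord θ u₀ (N + 1) i (Φ.flow t z))| ≤ ((N + 1 : ℕ) : ℝ) * C :=
  calc |∑ i, g (reducedCoord θ u₀ (N + 1) i (Φ.flow t z))|
      ≤ ∑ i, |g (reducedCoord θ u₀ (N + 1) i (Φ.flow t z))| := Finset.abs_sum_le_sum_abs _ _
    _ ≤ ∑ _i : Fin (N + 1), C := Finset.sum_le_sum fun i _ => hgC _
    _ = ((N + 1 : ℕ) : ℝ) * C := by simp

/-- **The one-body law tests the `N`-body law**: for bounded measurable `g` and a probability law `ν`,
`(N+1) ∫ g df_t = E_ν[∑ᵢ g(xᵢ(t), wᵢ(t))]` (change of variables under `Measure.map`, unfolding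
`oneBodyLaw`). -/
theorem integral_oneBodyLaw_eq {σ : ℝ} (θ : ℝ) (u₀ : V3) (N : ℕ) (Φ : Flow σ N) (ν : Measure (Phase N))
    [IsProbabilityMeasure ν] (t : ℝ) {g : T3 × V3 → ℝ} {C : ℝ} (hgm : Measurable g)
    (hgC : ∀ p, |g p| ≤ C) :
    ((N + 1 : ℕ) : ℝ) * ∫ p, g p ∂(oneBodyLaw θ u₀ Φ ν t) =
      ∫ z, ∑ i, g (reducedCoord θ u₀ (N + 1) i (Φ.flow t z)) ∂ν := by
  have hT : ∀ i : Fin (N + 1), Measurable fun z : Phase N => reducedCoord θ u₀ (N + 1) i (Φ.flow t z) :=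
    fun i => (measurable_reducedCoord θ u₀ (N + 1) i).comp (Φ.measurable_flow t)
  have hgi : ∀ i : Fin (N + 1),
      Integrable g (ν.map fun z => reducedCoord θ u₀ (N + 1) i (Φ.flow t z)) := fun i => by
    haveI : IsFiniteMeasure (ν.map fun z => reducedCoord θ u₀ (N + 1) i (Φ.flow t z)) :=
      Measure.isFiniteMeasure_map ν _
    exact Integrable.of_bound hgm.aestronglyMeasurable C
      (ae_of_all _ fun p => by rw [Real.norm_eq_abs]; exact hgC p)
  have hgTi : ∀ i : Fin (N + 1),
      Integrable (fun z => g (reducedCoord θ u₀ (N + 1) i (Φ.flow t z))) ν := fun i =>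
    Integrable.of_bound (hgm.comp (hT i)).aestronglyMeasurable C
      (ae_of_all _ fun z => by rw [Real.norm_eq_abs]; exact hgC _)
  have hn : ((N + 1 : ℕ) : ℝ) ≠ 0 := Nat.cast_ne_zero.2 (Nat.succ_ne_zero N)
  rw [oneBodyLaw, integral_smul_measure, integral_finsetSum_measure fun i _ => hgi i,
    integral_finsetSum _ fun i _ => hgTi i, ENNReal.toReal_inv, ENNReal.toReal_natCast, smul_eq_mul,
    ← mul_assoc, mul_inv_cancel₀ hn, one_mul]
  refine Finset.sum_congr rfl fun i _ => ?_
  exact integral_map (hT i).aemeasurable hgm.aestronglyMeasurable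

/-! ### Exponential moments of velocity-normalised one-body sums under the Gibbs law -/

/-- **Gaussian one-site factorisation in reduced velocities.** For constant profiles `a, θ > 0`,
`σ ≤ 1/2` and a measurable one-body `g` that is velocity-normalised, `∫ e^{g(x,w)} γ(dw) = 1` for every
`x` (`γ` the standard Gaussian, `w = (v − u₀)/√θ`), with `|g| ≤ C`:
`∫⁻ exp(∑ᵢ g(xᵢ, wᵢ)) dG_N ≤ 1`. -/
theorem lintegral_exp_sum_reducedCoord_gibbs_le {σ a θ : ℝ} (ha : 0 < a) (hθ : 0 < θ) (hσ : σ ≤ 1 / 2)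
    (u₀ : V3) (N : ℕ) (Φ : Flow σ N) {g : T3 × V3 → ℝ} {C : ℝ} (hgm : Measurable g)
    (hgC : ∀ p, |g p| ≤ C) (hg1 : ∀ x, ∫ w, Real.exp (g (x, w)) ∂(stdGaussian V3) = 1) :
    ∫⁻ z, ENNReal.ofReal (Real.exp (∑ i, g (reducedCoord θ u₀ (N + 1) i z)))
      ∂(gibbs σ a θ u₀ N Φ) ≤ 1 := by
  have hqm : Measurable fun p : T3 × V3 => g (p.1, (Real.sqrt θ)⁻¹ • (p.2 - u₀)) :=
    hgm.comp (by fun_prop)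
  have hC1 : ∀ x : T3, ∫⁻ v, ENNReal.ofReal (Real.exp (g (x, (Real.sqrt θ)⁻¹ • (v - u₀))))
      ∂(gaussMeasure u₀ θ) ≤ 1 := by
    intro x
    have hfm : Measurable fun w : V3 => ENNReal.ofReal (Real.exp (g (x, w))) :=
      (hgm.comp (measurable_const.prodMk measurable_id)).exp.ennreal_ofReal
    have hint : Integrable (fun w => Real.exp (g (x, w))) (stdGaussian V3) :=
      Integrable.of_bound (hgm.comp (measurable_const.prodMk measurable_id)).exp.aestronglyMeasurable
        (Real.exp C) (ae_of_all _ fun w => by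
          rw [Real.norm_eq_abs, abs_of_pos (Real.exp_pos _)]
          exact Real.exp_le_exp.2 ((le_abs_self _).trans (hgC _)))
    rw [lintegral_gaussMeasure_eq_lintegral_stdGaussian_sv hθ u₀
        (f := fun w => ENNReal.ofReal (Real.exp (g (x, w)))) hfm,
      ← ofReal_integral_eq_lintegral_ofReal hint (ae_of_all _ fun w => (Real.exp_pos _).le), hg1 x,
      ENNReal.ofReal_one]
  have h := lintegral_exp_sum_localGibbsMeasure_const_le ha hθ u₀ hσ N hqm hC1
  rw [← localGibbsLaw_eq σ (fun _ => a) (fun _ => u₀) (fun _ => θ) N Φ, one_pow] at h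
  exact h

/-- **One-body tests of the `N`-body entropy.** For constant profiles `a, θ > 0`, `σ ≤ 1/2`, a probability
law `ν` with `KL(ν ‖ G_N) < ∞`, a time `t` and a bounded measurable velocity-normalised one-body `g`
(`∫ e^{g(x,w)} γ(dw) = 1` for every `x`): `(N+1) ∫ g df_t ≤ KL(ν ‖ G_N)` — Donsker–Varadhan with
`Y = ∑ᵢ g(xᵢ(t), wᵢ(t))`, flow-invariance of `G_N` and `E_G e^Y ≤ 1`. -/
theorem integral_oneBodyLaw_le_klDiv {σ a θ : ℝ} (ha : 0 < a) (hθ : 0 < θ) (hσ : σ ≤ 1 / 2) (u₀ : V3)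
    (N : ℕ) (Φ : Flow σ N) (ν : Measure (Phase N)) [IsProbabilityMeasure ν]
    (hfin : klDiv ν (gibbs σ a θ u₀ N Φ) ≠ ⊤) (t : ℝ) {g : T3 × V3 → ℝ} {C : ℝ} (hgm : Measurable g)
    (hgC : ∀ p, |g p| ≤ C) (hg1 : ∀ x, ∫ w, Real.exp (g (x, w)) ∂(stdGaussian V3) = 1) :
    ((N + 1 : ℕ) : ℝ) * ∫ p, g p ∂(oneBodyLaw θ u₀ Φ ν t) ≤ (klDiv ν (gibbs σ a θ u₀ N Φ)).toReal := by
  haveI : IsProbabilityMeasure (gibbs σ a θ u₀ N Φ) := isProbabilityMeasure_gibbs ha hθ hσ u₀ N Φ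
  have hYm := measurable_sum_reducedCoord_flow θ u₀ N Φ t hgm
  have hYb := abs_sum_reducedCoord_le θ u₀ N Φ t hgC
  -- the static one-body sum `S(z) = ∑ᵢ g(xᵢ, wᵢ)`
  have hSm : Measurable fun z : Phase N => ∑ i, g (reducedCoord θ u₀ (N + 1) i z) :=
    Finset.measurable_sum _ fun i _ => hgm.comp (measurable_reducedCoord θ u₀ (N + 1) i)
  have hYν : Integrable (fun z => ∑ i, g (reducedCoord θ u₀ (N + 1) i (Φ.flow t z))) ν :=
    Integrable.of_bound hYm.aestronglyMeasurable _ (ae_of_all _ fun z => by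
      rw [Real.norm_eq_abs]; exact hYb z)
  have hexpY : Integrable (fun z => Real.exp (∑ i, g (reducedCoord θ u₀ (N + 1) i (Φ.flow t z))))
      (gibbs σ a θ u₀ N Φ) :=
    Integrable.of_bound hYm.exp.aestronglyMeasurable (Real.exp (((N + 1 : ℕ) : ℝ) * C))
      (ae_of_all _ fun z => by
        rw [Real.norm_eq_abs, abs_of_pos (Real.exp_pos _)]
        exact Real.exp_le_exp.2 ((le_abs_self _).trans (hYb z)))
  -- `E_G e^Y = E_G e^S ≤ 1`
  have hstat : ∫ z, Real.exp (∑ i, g (reducedCoord θ u₀ (N + 1) i (Φ.flow t z))) ∂(gibbs σ a θ u₀ N Φ) =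
      ∫ z, Real.exp (∑ i, g (reducedCoord θ u₀ (N + 1) i z)) ∂(gibbs σ a θ u₀ N Φ) :=
    integral_comp_flow_localGibbsLaw_const σ a θ u₀ N Φ t
      (f := fun z => Real.exp (∑ i, g (reducedCoord θ u₀ (N + 1) i z))) hSm.exp.aestronglyMeasurable
  have hle1 : ∫ z, Real.exp (∑ i, g (reducedCoord θ u₀ (N + 1) i (Φ.flow t z))) ∂(gibbs σ a θ u₀ N Φ)
      ≤ 1 := by
    rw [hstat, integral_eq_lintegral_of_nonneg_ae (ae_of_all _ fun z => (Real.exp_pos _).le)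
      hSm.exp.aestronglyMeasurable]
    refine ENNReal.toReal_le_of_le_ofReal zero_le_one ?_
    rw [ENNReal.ofReal_one]
    exact lintegral_exp_sum_reducedCoord_gibbs_le ha hθ hσ u₀ N Φ hgm hgC hg1
  have hlog : Real.log (∫ z, Real.exp (∑ i, g (reducedCoord θ u₀ (N + 1) i (Φ.flow t z)))
      ∂(gibbs σ a θ u₀ N Φ)) ≤ 0 :=
    Real.log_nonpos (integral_nonneg fun z => (Real.exp_pos _).le) hle1
  have hDV := LedgerAssembly.integral_le_klDiv_add_log hfin hYν hexpY
  rw [integral_oneBodyLaw_eq θ u₀ N Φ ν t hgm hgC]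
  linarith

/-! ### The registered stub -/

/-- **Velocity entropy budget** (registered stub `stub_velocityEntropyBudget` of the line
`h-theorem-dissipation-budget`): in the crux frame (`a, θ > 0`, `σ ≤ 1/2`), for a probability law
`ν ≪ G_N` with `KL(ν ‖ G_N) < ∞` and every time `t`, the velocity relative entropy of the reduced one-body
law is finite and `(N+1) · KL(f_t ‖ (f_t)₁ ⊗ γ) ≤ KL(ν ‖ G_N)`. The conditional Donsker–Varadhan upper
bound (`klDiv_fst_prod_le_of_forall`) applied to the one-body tests `integral_oneBodyLaw_le_klDiv`. -/
theorem stub_velocityEntropyBudget : VelocityEntropyBudget := by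
  intro σ a θ u₀ N Φ ν hν ha hθ hσ _hac hfin t
  haveI := isProbabilityMeasure_oneBodyLaw (Nat.succ_ne_zero N) θ u₀ Φ ν t
  have hn : (0 : ℝ) < ((N + 1 : ℕ) : ℝ) := Nat.cast_pos.2 (Nat.succ_pos N)
  set K : ℝ := (klDiv ν (gibbs σ a θ u₀ N Φ)).toReal / ((N + 1 : ℕ) : ℝ) with hK
  have hK0 : 0 ≤ K := div_nonneg ENNReal.toReal_nonneg hn.le
  have hle : velKL (oneBodyLaw θ u₀ Φ ν t) ≤ ENNReal.ofReal K := by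
    refine Literature.Probability.Divergences.klDiv_fst_prod_le_of_forall fun g C hgm hgC hg1 => ?_
    rw [hK, le_div_iff₀' hn]
    exact integral_oneBodyLaw_le_klDiv ha hθ hσ u₀ N Φ ν hfin t hgm hgC hg1
  refine ⟨ne_top_of_le_ne_top ENNReal.ofReal_ne_top hle, ?_⟩
  calc ((N + 1 : ℕ) : ℝ) * (velKL (oneBodyLaw θ u₀ Φ ν t)).toReal ≤ ((N + 1 : ℕ) : ℝ) * K :=
        mul_le_mul_of_nonneg_left (ENNReal.toReal_le_of_le_ofReal hK0 hle) hn.le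
    _ = (klDiv ν (gibbs σ a θ u₀ N Φ)).toReal := by
        rw [hK, mul_div_cancel₀ _ hn.ne']

end Summit.AtomisticToContinuum.HydrodynamicLimit.Theorems.HTheorem

end
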